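import Summits.MatrixMultiplication.MatrixMultiplication.Theorems.FarEdgeDescentLineRigidity
import HarnessLib

/-!
# Pencil Gram invariants of the BCZ line, I: the quadric pair `(det X, det_q X)` as Gram matrices

Route `FarEdgeDescent` (cell `decomp-mm`, lens 2 «structural dichotomy (special vs generic)»,
gen 39), Kernel XIV; support for the aside `SubLogRate` (stmt-MatrixMultiplication-25371).

Kernel XII (`FarEdgeDescentLineDetPair`, `FarEdgeDescentLineRigidity`) decided the degeneration
order on the closed BCZ line `{𝔖(q)}` (the same-support class of `⟨2,2,2⟩`) except for the arrows
`𝔖(q) → 𝔖(0)`, `q ∉ {0,1}`: there the first-order trailing data of the pair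
`(u - v, u - q v) = (det X, det_q X) ∘ Bᵀ` are consistent.  This file supplies the SECOND-ORDER
tool:
the two quadrics are carried by their (doubled) Gram matrices `S_c = B Ĵ_c Bᵀ`
(`Ĵ_c = Ĵ_1 · diag(1,c,c,1)`), and the first two coefficients of the Segre characteristic form
`det(S_q + t S_1)` are RELATIVE INVARIANTS of the pair under any substitution `B ∈ K[ε]^{4×4}`
(invertible or not):

* `det_gram_eq`: `det S_q = q² · det S_1`;
* `trace_adjugate_gram_one_mul`: `tr(adj S_1 · S_q) = (2 + 2q) · det S_1`;
* `mul_trace_adjugate_gram_mul`: `q · tr(adj S_q · S_1) = (2 + 2q) · det S_q`;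

together with the dictionary polynomial ↔ Gram matrix (`yv_quad_eq`, `coeff_quadForm₂`,
`add_transpose_eq_of_quadForm_eq` — a quadratic form determines `M + Mᵀ`, every characteristic)
and the order decomposition `gram_decomp`: if the trailing `ε`-coefficient of `u - c v` is
`κ · det_f X`, then `S_c = ε^a · S̃` with `S̃(0) = κ Ĵ_f`.  Part II
(`FarEdgeDescentLineAntichain`) compares `ε`-orders in the three identities and closes the last
arrows: the closed BCZ line is a total degeneration antichain (char `≠ 2`).

References: P. Bürgisser, M. Clausen, M. A. Shokrollahi, *Algebraic Complexity Theory* (1997),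
(15.19), §20.2 [BurgisserClausenShokrollahi1997]; M. Bläser, M. Christandl, J. Zuiddam,
arXiv:1705.09652, §2 [BlaserChristandlZuiddam2017]; J. Harris, *Algebraic Geometry: A First
Course* (1992), Lecture 22 (pencils of quadrics) [Harris1992]; W. V. D. Hodge, D. Pedoe, *Methods of
Algebraic Geometry* II (1994 reprint), Book IV, Ch. XIII §§10–11 (pairs of quadrics, Segre symbols)
[folklore].
-/

noncomputable section

open scoped BigOperators Polynomial Matrix

set_option linter.dupNamespace false

namespace Summit.MatrixMultiplication.MatrixMultiplication.Theorems.FarEdgeDescentPencilGram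

open Literature.Computability.AlgebraicComplexity
open Summit.MatrixMultiplication.MatrixMultiplication.Theorems.FarEdgeDescentSignTwistDet
open Summit.MatrixMultiplication.MatrixMultiplication.Theorems.FarEdgeDescentLineDetPair

universe u

/-- The index set of the `x`-variables `x₀₀, x₀₁, x₁₀, x₁₁`. [folklore] -/
abbrev Idx := Fin 2 × Fin 2

/-! ## The Gram matrices `Ĵ_q`, `J'_q` and the twist `d_q` -/

section GramMatrices
variable (R : Type*) [CommRing R]

/-- `Ĵ_q`, the doubled Gram matrix of `det_q X = x₀₀x₁₁ - q·x₀₁x₁₀` (entries `1` at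
`{(00,11),(11,00)}`, `-q` at `{(01,10),(10,01)}`). [folklore] -/
def Jh (q : R) : Matrix Idx Idx R := Matrix.of fun b c =>
  if b.1 ≠ c.1 ∧ b.2 ≠ c.2 then (if b.1 = b.2 then 1 else -q) else 0

/-- `J'_q`, the upper coefficient matrix of `det_q X` (entries `1` at `(00,11)`, `-q` at
`(01,10)`). [folklore] -/
def Jc (q : R) : Matrix Idx Idx R := Matrix.of fun b c =>
  if b.1 = 0 ∧ c.1 = 1 ∧ b.2 ≠ c.2 then (if b.2 = 0 then 1 else -q) else 0

/-- The diagonal twist `d_q = (1, q, q, 1)` with `Ĵ_q = Ĵ_1 · diag d_q`. [folklore] -/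
def dq (q : R) : Idx → R := fun b => if b.1 = b.2 then 1 else q

/-- `J'_q + J'_qᵀ = Ĵ_q`. [folklore] -/
theorem Jc_add_transpose (q : R) : Jc R q + (Jc R q)ᵀ = Jh R q := by
  ext ⟨i, j⟩ ⟨k, l⟩
  fin_cases i <;> fin_cases j <;> fin_cases k <;> fin_cases l <;>
    simp [Jc, Jh, Matrix.add_apply, Matrix.transpose_apply]

/-- `Ĵ_q = Ĵ_1 · diag(d_q)`. [folklore] -/
theorem Jh_eq_mul_diagonal (q : R) : Jh R q = Jh R 1 * Matrix.diagonal (dq R q) := by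
  ext ⟨i, j⟩ ⟨k, l⟩
  rw [Matrix.mul_diagonal]
  fin_cases i <;> fin_cases j <;> fin_cases k <;> fin_cases l <;> simp [Jh, dq]

/-- `Ĵ_1² = 1`. [folklore] -/
theorem Jh_one_mul_self : Jh R 1 * Jh R 1 = 1 := by
  ext ⟨i, j⟩ ⟨k, l⟩
  fin_cases i <;> fin_cases j <;> fin_cases k <;> fin_cases l <;>
    simp [Matrix.mul_apply, Fintype.sum_prod_type, Fin.sum_univ_two, Jh]

/-- `(det Ĵ_1)² = 1`. [folklore] -/
theorem det_Jh_one_mul_self : (Jh R 1).det * (Jh R 1).det = 1 := by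
  rw [← Matrix.det_mul, Jh_one_mul_self, Matrix.det_one]

/-- `adj Ĵ_1 = det Ĵ_1 · Ĵ_1`. [folklore] -/
theorem adjugate_Jh_one : (Jh R 1).adjugate = (Jh R 1).det • Jh R 1 := by
  calc (Jh R 1).adjugate = (Jh R 1).adjugate * (Jh R 1 * Jh R 1) := by
        rw [Jh_one_mul_self, Matrix.mul_one]
    _ = (Jh R 1).adjugate * Jh R 1 * Jh R 1 := by rw [Matrix.mul_assoc]
    _ = (Jh R 1).det • Jh R 1 := by rw [Matrix.adjugate_mul, Matrix.smul_mul, Matrix.one_mul]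

/-- `tr(Ĵ_1 · Ĵ_0) = 2` (`Ĵ_0` = doubled Gram matrix of `x₀₀x₁₁`). [folklore] -/
theorem trace_Jh_one_mul_Jh_zero : (Jh R 1 * Jh R 0).trace = 2 := by
  simp [Matrix.trace, Matrix.mul_apply, Fintype.sum_prod_type, Fin.sum_univ_two, Jh]
  norm_num

/-- `det Ĵ_0 = 0` (the row of `x₀₁` vanishes). [folklore] -/
theorem det_Jh_zero : (Jh R 0).det = 0 :=
  Matrix.det_eq_zero_of_row_eq_zero ((0 : Fin 2), (1 : Fin 2)) fun c => by
    obtain ⟨k, l⟩ := c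
    fin_cases k <;> fin_cases l <;> simp [Jh]

/-- `∏ d_q = q²`. [folklore] -/
theorem prod_dq (q : R) : ∏ b, dq R q b = q ^ 2 := by
  simp [Fintype.prod_prod_type, Fin.prod_univ_two, dq]
  ring

/-- `det diag(d_q) = q²`. [folklore] -/
theorem det_diagonal_dq (q : R) : (Matrix.diagonal (dq R q)).det = q ^ 2 := by
  rw [Matrix.det_diagonal, prod_dq]

/-- `tr diag(d_q) = 2 + 2q`. [folklore] -/
theorem trace_diagonal_dq (q : R) : (Matrix.diagonal (dq R q)).trace = 2 + 2 * q := by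
  simp [Matrix.trace, Fintype.sum_prod_type, Fin.sum_univ_two, dq]
  ring

/-- `q · tr(adj diag(d_q)) = 2q²(1 + q)` (no cancellation needed). [folklore] -/
theorem mul_trace_adjugate_diagonal_dq (q : R) :
    q * (Matrix.diagonal (dq R q)).adjugate.trace = 2 * q ^ 2 * (1 + q) := by
  rw [Matrix.adjugate_diagonal]
  have h : ∀ b : Idx, dq R q b * ∏ j ∈ Finset.univ.erase b, dq R q j = q ^ 2 := fun b => by
    rw [Finset.mul_prod_erase _ _ (Finset.mem_univ b), prod_dq]
  have d00 : dq R q (0, 0) = 1 := by simp [dq]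
  have d11 : dq R q (1, 1) = 1 := by simp [dq]
  have d01 : dq R q (0, 1) = q := by simp [dq]
  have d10 : dq R q (1, 0) = q := by simp [dq]
  have h00 := h (0, 0)
  have h01 := h (0, 1)
  have h10 := h (1, 0)
  have h11 := h (1, 1)
  rw [d00, one_mul] at h00
  rw [d11, one_mul] at h11
  rw [d01] at h01
  rw [d10] at h10
  simp only [Matrix.trace, Matrix.diag_apply, Matrix.diagonal_apply_eq, Fintype.sum_prod_type,
    Fin.sum_univ_two]
  linear_combination q * h00 + h01 + h10 + q * h11

end GramMatrices

/-! ## The three relative invariants of the pair `(S_1, S_q)` -/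

section Pencil
variable {R : Type*} [CommRing R] (B : Matrix Idx Idx R)

/-- `S_c := B Ĵ_c Bᵀ`, the doubled Gram matrix of `det_c X ∘ Bᵀ`. [folklore] -/
def gram (c : R) : Matrix Idx Idx R := B * Jh R c * Bᵀ

/-- `det S_c = (det B)² · det Ĵ_1 · c²`. [folklore] -/
theorem det_gram (c : R) : (gram B c).det = B.det ^ 2 * (Jh R 1).det * c ^ 2 := by
  rw [gram, Jh_eq_mul_diagonal R c, Matrix.det_mul, Matrix.det_mul, Matrix.det_mul,
    det_diagonal_dq, Matrix.det_transpose]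
  ring

/-- **(I1)** `det S_q = q² · det S_1`. [folklore] -/
theorem det_gram_eq (q : R) : (gram B q).det = q ^ 2 * (gram B 1).det := by
  rw [det_gram, det_gram]
  ring

/-- **(I2)** `tr(adj S_1 · S_q) = (2 + 2q) · det S_1` — the polarised discriminant.
[folklore] -/
theorem trace_adjugate_gram_one_mul (q : R) :
    ((gram B 1).adjugate * gram B q).trace = (2 + 2 * q) * (gram B 1).det := by
  have h1 : B.adjugate * B = B.det • (1 : Matrix Idx Idx R) := Matrix.adjugate_mul B
  have h2 : (Jh R 1).adjugate * Jh R 1 = (Jh R 1).det • (1 : Matrix Idx Idx R) :=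
    Matrix.adjugate_mul _
  have h3 : Bᵀ * Bᵀ.adjugate = Bᵀ.det • (1 : Matrix Idx Idx R) := Matrix.mul_adjugate _
  have e : (gram B 1).adjugate * gram B q =
      (B.det * (Jh R 1).det) • (Bᵀ.adjugate * Matrix.diagonal (dq R q) * Bᵀ) := by
    rw [gram, gram, Jh_eq_mul_diagonal R q, Matrix.adjugate_mul_distrib,
      Matrix.adjugate_mul_distrib]
    calc Bᵀ.adjugate * ((Jh R 1).adjugate * B.adjugate) *
          (B * (Jh R 1 * Matrix.diagonal (dq R q)) * Bᵀ)
        = Bᵀ.adjugate * ((Jh R 1).adjugate * ((B.adjugate * B) * Jh R 1)) *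
            Matrix.diagonal (dq R q) * Bᵀ := by simp only [Matrix.mul_assoc]
      _ = (B.det * (Jh R 1).det) • (Bᵀ.adjugate * Matrix.diagonal (dq R q) * Bᵀ) := by
          rw [h1, Matrix.smul_mul, Matrix.one_mul, Matrix.mul_smul, h2]
          simp only [Matrix.mul_smul, Matrix.smul_mul, Matrix.mul_one, smul_smul, Matrix.mul_assoc]
  rw [e, Matrix.trace_smul, Matrix.trace_mul_cycle, h3, Matrix.smul_mul, Matrix.one_mul,
    Matrix.trace_smul, trace_diagonal_dq, gram, Matrix.det_mul, Matrix.det_mul,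
    Matrix.det_transpose, smul_eq_mul, smul_eq_mul]
  ring

/-- **(I2′)** `q · tr(adj S_q · S_1) = (2 + 2q) · det S_q`. [folklore] -/
theorem mul_trace_adjugate_gram_mul (q : R) :
    q * ((gram B q).adjugate * gram B 1).trace = (2 + 2 * q) * (gram B q).det := by
  have h1 : B.adjugate * B = B.det • (1 : Matrix Idx Idx R) := Matrix.adjugate_mul B
  have h2 : (Jh R 1).adjugate * Jh R 1 = (Jh R 1).det • (1 : Matrix Idx Idx R) :=
    Matrix.adjugate_mul _
  have h3 : Bᵀ * Bᵀ.adjugate = Bᵀ.det • (1 : Matrix Idx Idx R) := Matrix.mul_adjugate _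
  have e : (gram B q).adjugate * gram B 1 = (B.det * (Jh R 1).det) •
      (Bᵀ.adjugate * (Matrix.diagonal (dq R q)).adjugate * Bᵀ) := by
    rw [gram, gram, Jh_eq_mul_diagonal R q, Matrix.adjugate_mul_distrib,
      Matrix.adjugate_mul_distrib, Matrix.adjugate_mul_distrib]
    calc Bᵀ.adjugate * ((Matrix.diagonal (dq R q)).adjugate * (Jh R 1).adjugate * B.adjugate) *
          (B * Jh R 1 * Bᵀ)
        = Bᵀ.adjugate * (Matrix.diagonal (dq R q)).adjugate *
            ((Jh R 1).adjugate * ((B.adjugate * B) * Jh R 1)) * Bᵀ := by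
          simp only [Matrix.mul_assoc]
      _ = (B.det * (Jh R 1).det) •
            (Bᵀ.adjugate * (Matrix.diagonal (dq R q)).adjugate * Bᵀ) := by
          rw [h1, Matrix.smul_mul, Matrix.one_mul, Matrix.mul_smul, h2]
          simp only [Matrix.mul_smul, Matrix.smul_mul, Matrix.mul_one, smul_smul, Matrix.mul_assoc]
  rw [e, Matrix.trace_smul, Matrix.trace_mul_cycle, h3, Matrix.smul_mul, Matrix.one_mul,
    Matrix.trace_smul, smul_eq_mul, smul_eq_mul, det_gram, Matrix.det_transpose]
  have h4 := mul_trace_adjugate_diagonal_dq R q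
  linear_combination B.det ^ 2 * (Jh R 1).det * h4

end Pencil

/-! ## The dictionary: quadratic forms and Gram matrices -/

section Bridge
variable {K : Type u} [Field K]

/-- The quadratic form `xᵀ M x` with (upper or any) coefficient matrix `M`. [folklore] -/
def quadForm (M : Matrix Idx Idx K) : Rx K :=
  ∑ b, ∑ c, MvPolynomial.C (M b c) * (MvPolynomial.X b * MvPolynomial.X c)

/-- `xᵀ M x` evaluated. [folklore] -/
theorem eval_quadForm (M : Matrix Idx Idx K) (x : Idx → K) :
    MvPolynomial.eval x (quadForm M) = x ⬝ᵥ (M *ᵥ x) := by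
  have e : x ⬝ᵥ (M *ᵥ x) = ∑ b, ∑ c, M b c * (x b * x c) := by
    simp only [dotProduct, Matrix.mulVec, Finset.mul_sum]
    exact Finset.sum_congr rfl fun b _ => Finset.sum_congr rfl fun c _ => by ring
  rw [e, quadForm]
  simp [map_sum]

/-- `eᵢᵀ M eⱼ = M i j`. [folklore] -/
theorem single_dotProduct_mulVec_single (M : Matrix Idx Idx K) (i j : Idx) :
    Pi.single i (1 : K) ⬝ᵥ (M *ᵥ Pi.single j 1) = M i j := by
  rw [Matrix.mulVec_single_one, single_one_dotProduct]
  rfl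

/-- **A quadratic form determines `M + Mᵀ`** (polarisation at `eᵢ + eⱼ`; every characteristic).
[folklore] -/
theorem add_transpose_eq_of_quadForm_eq {M N : Matrix Idx Idx K} (h : quadForm M = quadForm N) :
    M + Mᵀ = N + Nᵀ := by
  have hF : ∀ x : Idx → K, x ⬝ᵥ (M *ᵥ x) = x ⬝ᵥ (N *ᵥ x) := fun x => by
    rw [← eval_quadForm, ← eval_quadForm, h]
  ext i j
  have h1 := hF (Pi.single i 1 + Pi.single j 1)
  have h2 := hF (Pi.single i 1)
  have h3 := hF (Pi.single j 1)
  simp only [Matrix.mulVec_add, add_dotProduct, dotProduct_add,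
    single_dotProduct_mulVec_single] at h1 h2 h3
  simp only [Matrix.add_apply, Matrix.transpose_apply]
  linear_combination h1 - h2 - h3

/-- `quadForm 0 = 0`. [folklore] -/
theorem quadForm_zero : quadForm (0 : Matrix Idx Idx K) = 0 := by
  simp [quadForm]

/-- `xᵀ (κ J'_f) x = κ · det_f X`. [folklore] -/
theorem quadForm_smul_Jc (κ f : K) : quadForm (κ • Jc K f) = MvPolynomial.C κ * detXq K f := by
  simp [quadForm, Jc, Fintype.sum_prod_type, Fin.sum_univ_two, detXq]
  ring

/-- The `K[x][ε]`-valued quadratic form `∑ x_b x_c · N_{bc}(ε)`. [folklore] -/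
def quadForm₂ (N : Matrix Idx Idx K[X]) : (Rx K)[X] :=
  ∑ b, ∑ c, Polynomial.C (MvPolynomial.X b * MvPolynomial.X c) * φK (Fin 2 × Fin 2) (N b c)

/-- `ε`-coefficients of `quadForm₂ N` are the forms of the coefficient matrices. [folklore] -/
theorem coeff_quadForm₂ (N : Matrix Idx Idx K[X]) (k : ℕ) :
    (quadForm₂ N).coeff k = quadForm (N.map fun p => p.coeff k) := by
  simp only [quadForm₂, quadForm, Polynomial.finsetSum_coeff, Polynomial.coeff_C_mul, coeff_φK,
    Matrix.map_apply]
  exact Finset.sum_congr rfl fun b _ => Finset.sum_congr rfl fun c _ => mul_comm _ _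

/-- Entries of `B J'_c Bᵀ`. [folklore] -/
theorem mul_Jc_mul_transpose_apply (B : Matrix Idx Idx K[X]) (c : K[X]) (b b' : Idx) :
    (B * Jc K[X] c * Bᵀ) b b' = B b (0, 0) * B b' (1, 1) - c * (B b (0, 1) * B b' (1, 0)) := by
  simp [Matrix.mul_apply, Jc, Fintype.sum_prod_type, Fin.sum_univ_two]
  ring

/-- **`u - c·v = xᵀ (B J'_c Bᵀ) x`** for `y = Bᵀx`, `u = y₀₀y₁₁`, `v = y₀₁y₁₀`. [folklore] -/
theorem yv_quad_eq (B : Idx → Idx → K[X]) (c : K) :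
    yv B (0, 0) * yv B (1, 1) - yv B (0, 1) * yv B (1, 0) * Polynomial.C (MvPolynomial.C c) =
      quadForm₂ (Matrix.of B * Jc K[X] (Polynomial.C c) * (Matrix.of B)ᵀ) := by
  have e : ∀ b₁ b₂ : Idx, yv B b₁ * yv B b₂ = ∑ b, ∑ b',
      Polynomial.C (MvPolynomial.X b * MvPolynomial.X b') * φK (Fin 2 × Fin 2) (B b b₁ * B b' b₂) :=
    fun b₁ b₂ => by
      rw [yv, yv, Finset.sum_mul_sum]
      refine Finset.sum_congr rfl fun b _ => Finset.sum_congr rfl fun b' _ => ?_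
      rw [map_mul, map_mul]
      ring
  rw [e, e, Finset.sum_mul, ← Finset.sum_sub_distrib, quadForm₂]
  refine Finset.sum_congr rfl fun b _ => ?_
  rw [Finset.sum_mul, ← Finset.sum_sub_distrib]
  refine Finset.sum_congr rfl fun b' _ => ?_
  rw [mul_Jc_mul_transpose_apply, Matrix.of_apply, Matrix.of_apply, Matrix.of_apply,
    Matrix.of_apply]
  simp only [map_sub, map_mul, φK_C]
  ring

/-- `B J'_c Bᵀ + (B J'_c Bᵀ)ᵀ = S_c`. [folklore] -/
theorem gram_eq_add_transpose (B : Matrix Idx Idx K[X]) (c : K[X]) :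
    B * Jc K[X] c * Bᵀ + (B * Jc K[X] c * Bᵀ)ᵀ = gram B c := by
  rw [gram, ← Jc_add_transpose, Matrix.transpose_mul, Matrix.transpose_mul,
    Matrix.transpose_transpose, Matrix.mul_add, Matrix.add_mul, ← Matrix.mul_assoc]

/-- **Order decomposition.**  If the trailing `ε`-coefficient of `u - c·v` is `κ · det_f X`, then
`S_c = ε^a · S̃` with `S̃(0) = κ · Ĵ_f` (`a` = the `ε`-order of `u - c·v`).
[cite: BurgisserClausenShokrollahi1997, (15.19)] -/
theorem gram_decomp {B : Idx → Idx → K[X]} {c f κ : K}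
    (h : (yv B (0, 0) * yv B (1, 1) -
      yv B (0, 1) * yv B (1, 0) * Polynomial.C (MvPolynomial.C c)).trailingCoeff =
      MvPolynomial.C κ * detXq K f) :
    ∃ S : Matrix Idx Idx K[X],
      gram (Matrix.of B) (Polynomial.C c) = (Polynomial.X : K[X]) ^
        (yv B (0, 0) * yv B (1, 1) -
          yv B (0, 1) * yv B (1, 0) * Polynomial.C (MvPolynomial.C c)).natTrailingDegree • S ∧
      S.map (Polynomial.eval 0) = κ • Jh K f := by
  set p := yv B (0, 0) * yv B (1, 1) -
    yv B (0, 1) * yv B (1, 0) * Polynomial.C (MvPolynomial.C c) with hp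
  set N := Matrix.of B * Jc K[X] (Polynomial.C c) * (Matrix.of B)ᵀ with hN
  have hpN : p = quadForm₂ N := yv_quad_eq B c
  set a := p.natTrailingDegree with ha
  -- the symmetric parts of the coefficient matrices of `N`
  have hNg : N + Nᵀ = gram (Matrix.of B) (Polynomial.C c) := by
    rw [hN]
    exact gram_eq_add_transpose _ _
  have hsym : ∀ k, (N.map fun r => r.coeff k) + (N.map fun r => r.coeff k)ᵀ =
      (gram (Matrix.of B) (Polynomial.C c)).map fun r => r.coeff k := fun k => by
    rw [← hNg]
    refine Matrix.ext fun b b' => ?_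
    simp only [Matrix.add_apply, Matrix.transpose_apply, Matrix.map_apply, Polynomial.coeff_add]
  have hlow : ∀ k < a, ∀ b b', ((gram (Matrix.of B) (Polynomial.C c)) b b').coeff k = 0 := by
    intro k hk b b'
    have h0 : p.coeff k = 0 := Polynomial.coeff_eq_zero_of_lt_natTrailingDegree hk
    rw [hpN, coeff_quadForm₂, ← quadForm_zero] at h0
    have h1 := add_transpose_eq_of_quadForm_eq h0
    rw [hsym, Matrix.transpose_zero, add_zero] at h1
    simpa [Matrix.map_apply] using congrFun (congrFun h1 b) b'
  have htop : ∀ b b', ((gram (Matrix.of B) (Polynomial.C c)) b b').coeff a = κ * Jh K f b b' := by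
    intro b b'
    have h0 : p.coeff a = MvPolynomial.C κ * detXq K f := h
    rw [hpN, coeff_quadForm₂, ← quadForm_smul_Jc] at h0
    have h1 := add_transpose_eq_of_quadForm_eq h0
    rw [hsym, Matrix.transpose_smul, ← smul_add, Jc_add_transpose] at h1
    simpa [Matrix.map_apply] using congrFun (congrFun h1 b) b'
  have hdvd : ∀ b b', (Polynomial.X : K[X]) ^ a ∣ (gram (Matrix.of B) (Polynomial.C c)) b b' :=
    fun b b' => Polynomial.X_pow_dvd_iff.mpr fun k hk => hlow k hk b b'
  choose S hS using hdvd
  refine ⟨Matrix.of S, ?_, ?_⟩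
  · refine Matrix.ext fun b b' => ?_
    rw [Matrix.smul_apply, Matrix.of_apply, smul_eq_mul]
    exact hS b b'
  · refine Matrix.ext fun b b' => ?_
    rw [Matrix.map_apply, Matrix.of_apply, Matrix.smul_apply, smul_eq_mul,
      ← Polynomial.coeff_zero_eq_eval_zero, ← htop b b', hS b b', Polynomial.coeff_X_pow_mul']
    simp

end Bridge

end Summit.MatrixMultiplication.MatrixMultiplication.Theorems.FarEdgeDescentPencilGram

end
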